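import Literature.NumberTheory.Automorphic.MeyerSummationPoisson
import Literature.NumberTheory.Automorphic.MeyerRatStructure
import Literature.NumberTheory.Automorphic.MeyerFiniteIdeleUnits
import Literature.NumberTheory.Automorphic.GLnAdelicStructureProofs
import HarnessLib

/-!
# Meyer's global difference representation — proofs, `K = ℚ`: the theta vectors `G ⊗ 1_Ẑ`

Topic `NumberTheory/Automorphic`; namespace `Literature.NumberTheory.Automorphic.Meyer`. Sibling
PROOF file of `MeyerDifferenceRepresentation` (Step B of the plan for
`Meyer.spectralRealisation_rat` [Meyer2005, Thm. 5.11], the bridge between `H₊ ∩ H₋` and theta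
series for `K = ℚ`). For a function `G` on `ℝ` we form the adelic pure tensor
`F = G ⊗ 1_Ẑ ∈ 𝒮(𝔸_ℚ)` (Tate's standard unramified test function when `G` is a Gaussian) and
compute Meyer's summation map on it: `Σ F` is `𝒪̂ˣ`-invariant and on the classes
`[z(t) · (1, u)]`, `t > 0`, `u ∈ Ẑˣ`, it is the theta-type sum `∑_{n ∈ ℤ ∖ 0} G(n t)`
[Meyer2005, §5.2: `Σ(1_𝒪 ⊗ f̄) = ∏_p (1 - λ_p⁻¹)⁻¹ f̄`, i.e. `∑_{n ≥ 1}` for `ℚ`].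

* `Meyer.mixedSpaceEquivReal : mixedSpace ℚ ≃L[ℝ] ℝ` (**definition**) — `ℚ ⊗ ℝ = ℝ`, evaluation at
  the unique (real) place; `archCoord x = mixedSpaceEquivReal (ringEquiv_mixedSpace ℚ x_∞)` is
  multiplicative, sends `z(t)` to `t` and a principal adele `q` to `q`;
* `Meyer.ratTensor G = G ⊗ 1_Ẑ` (**definition**), `ratTensor_mem_schwartzBruhatAdele` (for
  `G ∈ 𝓢(ℝ, ℂ)`), `ratTensor_zero : (G ⊗ 1_Ẑ)(0) = G(0)`;
* `ratTensor_mul_finIdele` — `G ⊗ 1_Ẑ` is invariant under `(1, u)`, `u ∈ Ẑˣ`;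
  `meyerSum_ratTensor_mul_finiteUnitClass` — `Σ(G ⊗ 1_Ẑ)` is `𝒪̂ˣ`-invariant (unramified);
* **`ideleSum_ratTensor`** — `Σ(G ⊗ 1_Ẑ)(z(t)·(1,u)) = ∑_{n ∈ ℤ, n ≠ 0} G(n t)` (a rational `a`
  contributes iff `a u ∈ Ẑ` iff `a ∈ ℤ`); `meyerSum_ratTensor_eq` — `Σ(G ⊗ 1_Ẑ)(c) = ∑_{n ≠ 0} G(n|c|)`;
* `integral_ratTensor_eq_zero`, `adeleFourier_ratTensor_zero` — `∫ (G ⊗ 1_Ẑ) dμ = 0 = 𝔉(G ⊗ 1_Ẑ)(0)`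
  when `∫ G = 0` (product decomposition of Haar measure, `exists_haar_eq_smul_map_prod`);
* **`iMinus_meyerSum_ratTensor_mem_Hplus`** — for `G ∈ 𝓢(ℝ)` with `G(0) = 0 = ∫ G` and the self-dual
  `μ`: `(Σ(G ⊗ 1_Ẑ), Σ(G ⊗ 1_Ẑ)) ∈ H₊` (from `JΣ𝔉 = Σ + Sing`, `MeyerSummationPoisson`) — the supply
  of explicit vectors of `H₊ ∩ H₋` for the lower bound `mult(|x|^s, π₋) ≥ ord_s Λ`.

Everything is proved; two definitions, no named facts.

## References

* R. Meyer, *On a representation of the idele class group related to primes and zeros of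
  L-functions*, Duke Math. J. 127 (2005) = arXiv:math/0311468, §5.2, §5.3 [Meyer2005].
* J. Tate, in Cassels–Fröhlich (eds.), *Algebraic Number Theory* (1967), Ch. XV, §4.4
  [CasselsFrohlichANT1967].
-/

noncomputable section

open NumberField NumberField.InfinitePlace NumberField.mixedEmbedding IsDedekindDomain
open scoped NNReal Classical

namespace Literature.NumberTheory.Automorphic.Meyer

open Literature.NumberTheory.GaloisRepresentations

/-! ### `ℚ ⊗ ℝ = ℝ` -/

section MixedSpace

/-- `ℚ` has no complex place. [folklore] -/
theorem Rat.not_isComplex (w : InfinitePlace ℚ) : ¬ w.IsComplex :=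
  InfinitePlace.not_isComplex_iff_isReal.mpr (Rat.isReal_infinitePlace' w)

/-- The real places of `ℚ` form a one-point type. [folklore] -/
theorem Rat.eq_realPlace (w : {w : InfinitePlace ℚ // w.IsReal}) :
    w = ⟨Rat.infinitePlace, Rat.isReal_infinitePlace⟩ :=
  Subsingleton.elim _ _

/-- **`ℚ ⊗ ℝ = ℝ`**: Mathlib's mixed space `ℝ^{r₁} × ℂ^{r₂}` of `ℚ` (`r₁ = 1`, `r₂ = 0`) as a real
topological vector space is `ℝ`, by evaluation at the unique (real) infinite place.
[folklore] -/
def mixedSpaceEquivReal : mixedSpace ℚ ≃L[ℝ] ℝ where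
  toFun X := X.1 ⟨Rat.infinitePlace, Rat.isReal_infinitePlace⟩
  map_add' _ _ := rfl
  map_smul' _ _ := rfl
  invFun t := (fun _ => t, fun _ => 0)
  left_inv X := by
    refine Prod.ext (funext fun w => ?_) (funext fun w => absurd w.2 (Rat.not_isComplex w.1))
    rw [Rat.eq_realPlace w]
  right_inv _ := rfl
  continuous_toFun := (continuous_apply _).comp continuous_fst
  continuous_invFun := (continuous_pi fun _ => continuous_id).prodMk continuous_const

/-- Unfolding of `mixedSpaceEquivReal`. [folklore] -/
theorem mixedSpaceEquivReal_apply (X : mixedSpace ℚ) :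
    mixedSpaceEquivReal X = X.1 ⟨Rat.infinitePlace, Rat.isReal_infinitePlace⟩ := rfl

/-- The archimedean coordinate `𝔸_{ℚ,∞} → ℝ` is multiplicative. [folklore] -/
theorem mixedSpaceEquivReal_ringEquiv_mul (x y : InfiniteAdeleRing ℚ) :
    mixedSpaceEquivReal (InfiniteAdeleRing.ringEquiv_mixedSpace ℚ (x * y)) =
      mixedSpaceEquivReal (InfiniteAdeleRing.ringEquiv_mixedSpace ℚ x) *
        mixedSpaceEquivReal (InfiniteAdeleRing.ringEquiv_mixedSpace ℚ y) := by
  rw [map_mul, mixedSpaceEquivReal_apply, mixedSpaceEquivReal_apply, mixedSpaceEquivReal_apply,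
    Prod.fst_mul, Pi.mul_apply]

/-- The archimedean coordinate of `0` is `0`. [folklore] -/
theorem mixedSpaceEquivReal_ringEquiv_zero :
    mixedSpaceEquivReal (InfiniteAdeleRing.ringEquiv_mixedSpace ℚ 0) = 0 := by
  rw [map_zero, map_zero]

/-- The archimedean coordinate of the diagonal real scalar `z(t)` is `t`. [folklore] -/
theorem mixedSpaceEquivReal_ringEquiv_realToInfiniteAdele (t : ℝ) :
    mixedSpaceEquivReal (InfiniteAdeleRing.ringEquiv_mixedSpace ℚ (realToInfiniteAdele ℚ t)) = t := by
  have h : InfiniteAdeleRing.ringEquiv_mixedSpace ℚ (realToInfiniteAdele ℚ t) =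
      algebraMap ℝ (mixedSpace ℚ) t := by
    change InfiniteAdeleRing.ringEquiv_mixedSpace ℚ
      ((InfiniteAdeleRing.ringEquiv_mixedSpace ℚ).symm (algebraMap ℝ (mixedSpace ℚ) t)) = _
    exact RingEquiv.apply_symm_apply _ _
  rw [h, mixedSpaceEquivReal_apply]
  simp only [Prod.algebraMap_apply, Pi.algebraMap_apply, Algebra.algebraMap_self, RingHom.id_apply]

/-- The archimedean coordinate of a principal adele `q ∈ ℚ` is `q`. [folklore] -/
theorem mixedSpaceEquivReal_ringEquiv_algebraMap (q : ℚ) :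
    mixedSpaceEquivReal (InfiniteAdeleRing.ringEquiv_mixedSpace ℚ (algebraMap ℚ (InfiniteAdeleRing ℚ) q)) = q := by
  have h : InfiniteAdeleRing.ringEquiv_mixedSpace ℚ (algebraMap ℚ (InfiniteAdeleRing ℚ) q) =
      mixedEmbedding ℚ q := by
    rw [InfiniteAdeleRing.mixedEmbedding_eq_algebraMap_comp]
  rw [h, mixedSpaceEquivReal_apply, mixedEmbedding_apply_isReal, eq_ratCast]

end MixedSpace

/-! ### The pure tensor `G ⊗ 1_Ẑ` -/

section Tensor

/-- **`1_𝒪̂` is a Schwartz–Bruhat function on `𝔸_K^∞`** (`𝒪̂` is compact open). [folklore] -/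
theorem indicator_integralFiniteAdeles_mem_schwartzBruhat (K : Type) [Field K] [NumberField K] :
    (integralFiniteAdeles K : Set (FiniteAdeleRing (𝓞 K) K)).indicator (1 : FiniteAdeleRing (𝓞 K) K → ℂ) ∈
      SchwartzBruhat (FiniteAdeleRing (𝓞 K) K) := by
  haveI : T2Space (FiniteAdeleRing (𝓞 K) K) := inferInstanceAs <| T2Space
    (RestrictedProduct (fun w : HeightOneSpectrum (𝓞 K) => w.adicCompletion K)
      (fun w => (w.adicCompletionIntegers K : Set (w.adicCompletion K))) Filter.cofinite)
  have hO : IsOpen (integralFiniteAdeles K : Set (FiniteAdeleRing (𝓞 K) K)) := isOpen_integralFiniteAdeles K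
  have hC : IsCompact (integralFiniteAdeles K : Set (FiniteAdeleRing (𝓞 K) K)) := isCompact_integralFiniteAdeles K
  have hcl : IsClosed (integralFiniteAdeles K : Set (FiniteAdeleRing (𝓞 K) K)) := hC.isClosed
  rw [mem_schwartzBruhat_iff]
  constructor
  · rw [IsLocallyConstant.iff_exists_open]
    intro y
    by_cases hy : y ∈ (integralFiniteAdeles K : Set (FiniteAdeleRing (𝓞 K) K))
    · exact ⟨_, hO, hy, fun z hz => by rw [Set.indicator_of_mem hz, Set.indicator_of_mem hy]; rfl⟩
    · exact ⟨_, hcl.isOpen_compl, hy, fun z hz => by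
        rw [Set.indicator_of_notMem hz, Set.indicator_of_notMem hy]⟩
  · exact HasCompactSupport.intro hC fun y hy => Set.indicator_of_notMem hy _

/-- **The pure tensor `G ⊗ 1_Ẑ`** on `𝔸_ℚ = ℝ × 𝔸_ℚ^∞`: `x ↦ G(x_∞) · 1_Ẑ(x_f)` (Tate's standard
unramified test function when `G(t) = e^{-πt²}`). [cite: CasselsFrohlichANT1967, Ch. XV §4.4] -/
def ratTensor (G : ℝ → ℂ) : AdeleRing (𝓞 ℚ) ℚ → ℂ := fun x =>
  G (mixedSpaceEquivReal (InfiniteAdeleRing.ringEquiv_mixedSpace ℚ x.1)) *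
    (integralFiniteAdeles ℚ : Set (FiniteAdeleRing (𝓞 ℚ) ℚ)).indicator (1 : FiniteAdeleRing (𝓞 ℚ) ℚ → ℂ) x.2

/-- Unfolding of `ratTensor`. [folklore] -/
theorem ratTensor_apply (G : ℝ → ℂ) (x : AdeleRing (𝓞 ℚ) ℚ) :
    ratTensor G x = G (mixedSpaceEquivReal (InfiniteAdeleRing.ringEquiv_mixedSpace ℚ x.1)) *
      (integralFiniteAdeles ℚ : Set (FiniteAdeleRing (𝓞 ℚ) ℚ)).indicator (1 : FiniteAdeleRing (𝓞 ℚ) ℚ → ℂ) x.2 := rfl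

/-- **`G ⊗ 1_Ẑ ∈ 𝒮(𝔸_ℚ)` for a Schwartz function `G`.** [cite: Meyer2005, §5.1] -/
theorem ratTensor_mem_schwartzBruhatAdele (G : SchwartzMap ℝ ℂ) :
    ratTensor G ∈ schwartzBruhatAdele ℚ := by
  have h := tensor_mem_schwartzBruhatAdele (K := ℚ)
    (SchwartzMap.compCLMOfContinuousLinearEquiv ℂ mixedSpaceEquivReal G)
    (indicator_integralFiniteAdeles_mem_schwartzBruhat ℚ)
  convert h using 2 with x
  rw [ratTensor_apply, SchwartzMap.compCLMOfContinuousLinearEquiv_apply, Function.comp_apply]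

/-- `(G ⊗ 1_Ẑ)(0) = G(0)`. [folklore] -/
theorem ratTensor_zero (G : ℝ → ℂ) : ratTensor G 0 = G 0 := by
  rw [ratTensor_apply, show (0 : AdeleRing (𝓞 ℚ) ℚ).1 = 0 from rfl, mixedSpaceEquivReal_ringEquiv_zero,
    show (0 : AdeleRing (𝓞 ℚ) ℚ).2 = 0 from rfl, Set.indicator_of_mem (zero_mem _), Pi.one_apply, mul_one]

/-- Multiplication by an integral unit preserves `𝒪̂`. [folklore] -/
theorem mul_unit_mem_integralFiniteAdeles_iff {K : Type} [Field K] [NumberField K]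
    {u : (FiniteAdeleRing (𝓞 K) K)ˣ} (hu : u ∈ integralFiniteUnits K) (b : FiniteAdeleRing (𝓞 K) K) :
    b * (u : FiniteAdeleRing (𝓞 K) K) ∈ integralFiniteAdeles K ↔ b ∈ integralFiniteAdeles K := by
  have h1 : (u : FiniteAdeleRing (𝓞 K) K) ∈ integralFiniteAdeles K := fun v => (hu v).1
  have h2 : ((u⁻¹ : (FiniteAdeleRing (𝓞 K) K)ˣ) : FiniteAdeleRing (𝓞 K) K) ∈ integralFiniteAdeles K :=
    fun v => (hu v).2
  constructor
  · intro h
    have h' := mul_mem h h2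
    rwa [mul_assoc, ← Units.val_mul, mul_inv_cancel, Units.val_one, mul_one] at h'
  · intro h
    exact mul_mem h h1

/-- **`G ⊗ 1_Ẑ` is invariant under `(1, u)`, `u ∈ Ẑˣ`.** [cite: Meyer2005, §5.2] -/
theorem ratTensor_mul_finIdele (G : ℝ → ℂ) {u : (FiniteAdeleRing (𝓞 ℚ) ℚ)ˣ}
    (hu : u ∈ integralFiniteUnits ℚ) (y : AdeleRing (𝓞 ℚ) ℚ) :
    ratTensor G (y * (finIdele ℚ u : AdeleRing (𝓞 ℚ) ℚ)) = ratTensor G y := by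
  rw [mul_finIdele_eq, ratTensor_apply, ratTensor_apply]
  congr 1
  by_cases hy : y.2 ∈ (integralFiniteAdeles ℚ : Set (FiniteAdeleRing (𝓞 ℚ) ℚ))
  · rw [Set.indicator_of_mem hy, Set.indicator_of_mem ((mul_unit_mem_integralFiniteAdeles_iff hu _).mpr hy)]
    rfl
  · rw [Set.indicator_of_notMem hy, Set.indicator_of_notMem]
    exact fun h => hy ((mul_unit_mem_integralFiniteAdeles_iff hu _).mp h)

/-- **`Σ(G ⊗ 1_Ẑ)` is unramified**: invariant under `finiteUnitClass u`, `u ∈ 𝒪̂ˣ`.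
[cite: Meyer2005, §5.2] -/
theorem meyerSum_ratTensor_mul_finiteUnitClass (G : ℝ → ℂ) {u : (FiniteAdeleRing (𝓞 ℚ) ℚ)ˣ}
    (hu : u ∈ integralFiniteUnits ℚ) (c : IdeleClassGroup ℚ) :
    meyerSum ℚ (ratTensor G) (c * finiteUnitClass ℚ u) = meyerSum ℚ (ratTensor G) c := by
  induction c using QuotientGroup.induction_on with
  | H x =>
    rw [finiteUnitClass_eq, IdeleClassGroup.mk_apply, ← QuotientGroup.mk_mul, meyerSum_mk, meyerSum_mk]
    unfold ideleSum
    refine tsum_congr fun a => ?_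
    rw [Units.val_mul, ← mul_assoc, ratTensor_mul_finIdele G hu]

end Tensor

/-! ### `Σ(G ⊗ 1_Ẑ)(z(t)·(1,u)) = ∑_{n ≠ 0} G(nt)` -/

section Sum

/-- A rational number is a finite-integral adele iff it is an integer. [folklore] -/
theorem algebraMap_mem_integralFiniteAdeles_iff (a : ℚ) :
    algebraMap ℚ (FiniteAdeleRing (𝓞 ℚ) ℚ) a ∈ integralFiniteAdeles ℚ ↔ ∃ n : ℤ, (n : ℚ) = a := by
  have h := isFiniteIntegral_algebraMap_iff ℚ a
  have h' : IsFiniteIntegral ℚ (algebraMap ℚ (AdeleRing (𝓞 ℚ) ℚ) a) ↔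
      algebraMap ℚ (FiniteAdeleRing (𝓞 ℚ) ℚ) a ∈ integralFiniteAdeles ℚ := Iff.rfl
  rw [← h', h]
  constructor
  · rintro ⟨r, hr⟩
    refine ⟨Rat.ringOfIntegersEquiv r, ?_⟩
    rw [← hr]
    exact Rat.ringOfIntegersEquiv_apply_coe r
  · rintro ⟨n, rfl⟩
    exact ⟨Rat.ringOfIntegersEquiv.symm n, Rat.ringOfIntegersEquiv_symm_apply_coe n⟩

/-- The value of `G ⊗ 1_Ẑ` at `a · z(t) · (1,u)` (`a ∈ ℚˣ`, `t > 0`, `u ∈ Ẑˣ`): `G(a t)` if `a ∈ ℤ`,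
else `0`. [cite: Meyer2005, §5.2] -/
theorem ratTensor_algebraMap_mul (G : ℝ → ℂ) (t : ℝ≥0ˣ) {u : (FiniteAdeleRing (𝓞 ℚ) ℚ)ˣ}
    (hu : u ∈ integralFiniteUnits ℚ) (a : ℚˣ) :
    ratTensor G (algebraMap ℚ (AdeleRing (𝓞 ℚ) ℚ) (a : ℚ) *
        ((posRealIdele ℚ t * finIdele ℚ u : ideleGroup ℚ) : AdeleRing (𝓞 ℚ) ℚ)) =
      if ∃ n : ℤ, (n : ℚ) = a then G ((a : ℚ) * ((t : ℝ≥0) : ℝ)) else 0 := by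
  rw [Units.val_mul, ← mul_assoc, ratTensor_mul_finIdele G hu, ratTensor_apply]
  -- archimedean coordinate
  have harch : mixedSpaceEquivReal (InfiniteAdeleRing.ringEquiv_mixedSpace ℚ
      (algebraMap ℚ (AdeleRing (𝓞 ℚ) ℚ) (a : ℚ) * ((posRealIdele ℚ t : ideleGroup ℚ) : AdeleRing (𝓞 ℚ) ℚ)).1) =
      (a : ℚ) * ((t : ℝ≥0) : ℝ) := by
    rw [show (algebraMap ℚ (AdeleRing (𝓞 ℚ) ℚ) (a : ℚ) *
        ((posRealIdele ℚ t : ideleGroup ℚ) : AdeleRing (𝓞 ℚ) ℚ)).1 =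
        algebraMap ℚ (InfiniteAdeleRing ℚ) (a : ℚ) * ((posRealIdele ℚ t : ideleGroup ℚ) : AdeleRing (𝓞 ℚ) ℚ).1
        from rfl, mixedSpaceEquivReal_ringEquiv_mul, mixedSpaceEquivReal_ringEquiv_algebraMap, posRealIdele_fst,
      mixedSpaceEquivReal_ringEquiv_realToInfiniteAdele]
  -- finite coordinate
  have hfin : (algebraMap ℚ (AdeleRing (𝓞 ℚ) ℚ) (a : ℚ) *
      ((posRealIdele ℚ t : ideleGroup ℚ) : AdeleRing (𝓞 ℚ) ℚ)).2 = algebraMap ℚ (FiniteAdeleRing (𝓞 ℚ) ℚ) (a : ℚ) := by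
    rw [show (algebraMap ℚ (AdeleRing (𝓞 ℚ) ℚ) (a : ℚ) *
        ((posRealIdele ℚ t : ideleGroup ℚ) : AdeleRing (𝓞 ℚ) ℚ)).2 =
        algebraMap ℚ (FiniteAdeleRing (𝓞 ℚ) ℚ) (a : ℚ) * ((posRealIdele ℚ t : ideleGroup ℚ) : AdeleRing (𝓞 ℚ) ℚ).2
        from rfl, posRealIdele_snd, mul_one]
  rw [harch, hfin]
  by_cases ha : ∃ n : ℤ, (n : ℚ) = a
  · rw [if_pos ha, Set.indicator_of_mem ((algebraMap_mem_integralFiniteAdeles_iff _).mpr ha), Pi.one_apply, mul_one]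
  · rw [if_neg ha, Set.indicator_of_notMem (fun h => ha ((algebraMap_mem_integralFiniteAdeles_iff _).mp h)),
      mul_zero]

/-- **`Σ(G ⊗ 1_Ẑ)(z(t)·(1,u)) = ∑_{n ∈ ℤ, n ≠ 0} G(nt)`** for `t > 0` and `u ∈ Ẑˣ`: in the sum over
`a ∈ ℚˣ` exactly the non-zero integers contribute [Meyer2005, §5.2:
`Σ(1_𝒪 ⊗ f̄) = ∏_p (1 - λ_{p}⁻¹)⁻¹ f̄`]. [cite: Meyer2005, §5.2] -/
theorem ideleSum_ratTensor (G : ℝ → ℂ) (t : ℝ≥0ˣ) {u : (FiniteAdeleRing (𝓞 ℚ) ℚ)ˣ}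
    (hu : u ∈ integralFiniteUnits ℚ) :
    ideleSum ℚ (ratTensor G) (posRealIdele ℚ t * finIdele ℚ u) =
      ∑' n : ℤ, if n = 0 then 0 else G (n * ((t : ℝ≥0) : ℝ)) := by
  classical
  unfold ideleSum
  simp_rw [ratTensor_algebraMap_mul G t hu]
  -- reindex the sum over `ℚˣ` along the non-zero integers
  set j : ({n : ℤ | n ≠ 0} : Set ℤ) → ℚˣ := fun n => Units.mk0 ((n : ℤ) : ℚ)
    (by exact_mod_cast (Set.mem_setOf.mp n.2)) with hj
  have hjinj : Function.Injective j := by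
    intro m n h
    have h' := congrArg (fun q : ℚˣ => (q : ℚ)) h
    simp only [hj, Units.val_mk0, Int.cast_inj] at h'
    exact Subtype.ext h'
  have hsupp : Function.support (fun a : ℚˣ => if ∃ n : ℤ, (n : ℚ) = a then G ((a : ℚ) * ((t : ℝ≥0) : ℝ)) else 0) ⊆
      Set.range j := by
    intro a ha
    rw [Function.mem_support] at ha
    by_cases h : ∃ n : ℤ, (n : ℚ) = a
    · obtain ⟨n, hn⟩ := h
      have hn0 : n ≠ 0 := by
        rintro rfl
        exact a.ne_zero (by rw [← hn, Int.cast_zero])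
      exact ⟨⟨n, Set.mem_setOf.mpr hn0⟩, Units.ext (by simp [hj, hn])⟩
    · exact absurd (if_neg h) ha
  rw [← hjinj.tsum_eq hsupp]
  have hterm : ∀ n : ({n : ℤ | n ≠ 0} : Set ℤ),
      (if ∃ m : ℤ, (m : ℚ) = (j n : ℚ) then G (((j n : ℚˣ) : ℚ) * ((t : ℝ≥0) : ℝ)) else 0) =
        G ((n : ℤ) * ((t : ℝ≥0) : ℝ)) := by
    intro n
    rw [if_pos ⟨n, by simp [hj]⟩]
    simp [hj]
  simp_rw [hterm]
  rw [tsum_subtype {n : ℤ | n ≠ 0} (fun n : ℤ => G (n * ((t : ℝ≥0) : ℝ)))]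
  refine tsum_congr fun n => ?_
  by_cases hn : n = 0
  · rw [if_pos hn, Set.indicator_of_notMem (by simpa using hn)]
  · rw [if_neg hn, Set.indicator_of_mem (by simpa using hn)]

/-- Class form: `Σ(G ⊗ 1_Ẑ)([z(t)] · finiteUnitClass u) = ∑_{n ≠ 0} G(nt)`. [cite: Meyer2005, §5.2] -/
theorem meyerSum_ratTensor_mk_posRealIdele_mul (G : ℝ → ℂ) (t : ℝ≥0ˣ) {u : (FiniteAdeleRing (𝓞 ℚ) ℚ)ˣ}
    (hu : u ∈ integralFiniteUnits ℚ) :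
    meyerSum ℚ (ratTensor G) (IdeleClassGroup.mk ℚ (posRealIdele ℚ t) * finiteUnitClass ℚ u) =
      ∑' n : ℤ, if n = 0 then 0 else G (n * ((t : ℝ≥0) : ℝ)) := by
  rw [finiteUnitClass_eq, IdeleClassGroup.mk_apply, IdeleClassGroup.mk_apply, ← QuotientGroup.mk_mul, meyerSum_mk,
    ideleSum_ratTensor G t hu]

/-- **`Σ(G ⊗ 1_Ẑ)` as a function of the norm**: for every idele class `c` of `ℚ`,
`Σ(G ⊗ 1_Ẑ)(c) = ∑_{n ≠ 0} G(n |c|)`. [cite: Meyer2005, §5.2] -/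
theorem meyerSum_ratTensor_eq (G : ℝ → ℂ) (c : IdeleClassGroup ℚ) :
    meyerSum ℚ (ratTensor G) c = ∑' n : ℤ, if n = 0 then 0 else G (n * classNorm ℚ c) := by
  obtain ⟨u, hu, hc⟩ := exists_eq_mk_posRealIdele_mul c
  conv_lhs => rw [hc]
  rw [meyerSum_ratTensor_mk_posRealIdele_mul G _ hu]
  rfl

end Sum

/-! ### `∫ (G ⊗ 1_Ẑ) dμ = 0` when `∫ G = 0`, and the theta vectors of `H₊` -/

section Integral

open MeasureTheory MeasureTheory.Measure

variable [MeasurableSpace (AdeleRing (𝓞 ℚ) ℚ)] [BorelSpace (AdeleRing (𝓞 ℚ) ℚ)]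
  (μ : Measure (AdeleRing (𝓞 ℚ) ℚ)) [μ.IsAddHaarMeasure]

/-- **`∫_{𝔸_ℚ} (G ⊗ 1_Ẑ) dμ = 0` if `∫_ℝ G = 0`**, for every Haar measure `μ` (the integral of a pure
tensor is a multiple of the product of the local integrals). [cite: CasselsFrohlichANT1967, Ch. XV §3.3] -/
theorem integral_ratTensor_eq_zero (G : SchwartzMap ℝ ℂ) (hG : ∫ t : ℝ, G t = 0) :
    ∫ x, ratTensor G x ∂μ = 0 := by
  haveI := secondCountableTopology_adeleRing ℚ
  haveI := locallyCompactSpace_adeleRing' ℚ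
  haveI := secondCountableTopology_finiteAdeleRing ℚ
  haveI := locallyCompactSpace_finiteAdeleRing' ℚ
  letI : MeasurableSpace (FiniteAdeleRing (𝓞 ℚ) ℚ) := borel _
  haveI : BorelSpace (FiniteAdeleRing (𝓞 ℚ) ℚ) := ⟨rfl⟩
  haveI : BorelSpace (Fin 1 → mixedSpace ℚ) := Pi.borelSpace
  haveI : BorelSpace (Fin 1 → FiniteAdeleRing (𝓞 ℚ) ℚ) := Pi.borelSpace
  -- transport `μ` to `𝔸_ℚ^{Fin 1}`
  set ν := μ.map (MeasurableEquiv.funUnique (Fin 1) (AdeleRing (𝓞 ℚ) ℚ)).symm with hν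
  haveI := isAddHaarMeasure_map_funUnique_symm μ
  have h1 : ∫ x, ratTensor G x ∂μ = ∫ v, ratTensor G (v 0) ∂ν := by
    rw [hν, integral_map_equiv]
    rfl
  -- split the Haar measure
  set μE : Measure (Fin 1 → mixedSpace ℚ) := Measure.addHaar with hμE
  set μf : Measure (Fin 1 → FiniteAdeleRing (𝓞 ℚ) ℚ) := Measure.addHaar with hμf
  obtain ⟨c, -, hνc⟩ := exists_haar_eq_smul_map_prod ℚ (Fin 1) ν μE μf
  rw [h1, integral_eq_smul_integral_prod hνc]
  have hsplit : ∀ p : (Fin 1 → mixedSpace ℚ) × (Fin 1 → FiniteAdeleRing (𝓞 ℚ) ℚ),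
      ratTensor G (piAdeleSplit ℚ (Fin 1) p 0) =
        (G (mixedSpaceEquivReal (p.1 0)) : ℂ) *
          (integralFiniteAdeles ℚ : Set (FiniteAdeleRing (𝓞 ℚ) ℚ)).indicator
            (1 : FiniteAdeleRing (𝓞 ℚ) ℚ → ℂ) (p.2 0) := by
    intro p
    rw [ratTensor_apply, piAdeleSplit_apply_fst, piAdeleSplit_apply_snd, RingEquiv.apply_symm_apply]
  simp_rw [hsplit]
  rw [integral_prod_mul (μ := μE) (ν := μf) (fun a : Fin 1 → mixedSpace ℚ => (G (mixedSpaceEquivReal (a 0)) : ℂ))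
    (fun b : Fin 1 → FiniteAdeleRing (𝓞 ℚ) ℚ =>
      (integralFiniteAdeles ℚ : Set (FiniteAdeleRing (𝓞 ℚ) ℚ)).indicator (1 : FiniteAdeleRing (𝓞 ℚ) ℚ → ℂ) (b 0))]
  -- the archimedean factor is a multiple of `∫ G = 0`
  have harch : ∫ a : Fin 1 → mixedSpace ℚ, (G (mixedSpaceEquivReal (a 0)) : ℂ) ∂μE = 0 := by
    set T : (Fin 1 → mixedSpace ℚ) ≃L[ℝ] ℝ :=
      (ContinuousLinearEquiv.funUnique (Fin 1) ℝ (mixedSpace ℚ)).trans mixedSpaceEquivReal with hT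
    have hTa : ∀ a : Fin 1 → mixedSpace ℚ, mixedSpaceEquivReal (a 0) = T a := fun a => rfl
    simp_rw [hTa]
    have h2 : ∫ a, (G (T a) : ℂ) ∂μE = ∫ t, G t ∂(μE.map T) := by
      rw [show (⇑T : (Fin 1 → mixedSpace ℚ) → ℝ) = ⇑T.toHomeomorph.toMeasurableEquiv by
        rw [Homeomorph.toMeasurableEquiv_coe]; rfl, integral_map_equiv]
    haveI : (μE.map T).IsAddHaarMeasure := T.isAddHaarMeasure_map μE
    rw [h2, isAddLeftInvariant_eq_smul (μE.map T) (volume : Measure ℝ), integral_smul_nnreal_measure, hG,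
      smul_zero]
  rw [harch, zero_mul, smul_zero]

/-- `𝔉(G ⊗ 1_Ẑ)(0) = 0` if `∫_ℝ G = 0`. [cite: Meyer2005, §5.4] -/
theorem adeleFourier_ratTensor_zero (G : SchwartzMap ℝ ℂ) (hG : ∫ t : ℝ, G t = 0) :
    adeleFourier ℚ μ (ratTensor G) 0 = 0 := by
  unfold adeleFourier
  simp only [mul_zero, AddChar.map_zero_eq_one, Circle.coe_one, mul_one]
  exact integral_ratTensor_eq_zero μ G hG

/-- **The theta vectors of `H₊ ∩ diagonal`** [Meyer2005, Lemma 5.5 / §5.7]: for a Schwartz function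
`G` on `ℝ` with `G(0) = 0` and `∫ G = 0` and the self-dual Haar measure `μ` on `𝔸_ℚ`, the pair
`(Σ(G ⊗ 1_Ẑ), Σ(G ⊗ 1_Ẑ))` lies in `H₊` — with `Σ(G ⊗ 1_Ẑ)(c) = ∑_{n ≠ 0} G(n|c|)`
(`meyerSum_ratTensor_eq`). [cite: Meyer2005, Lemma 5.5] -/
theorem iMinus_meyerSum_ratTensor_mem_Hplus (hμ : μ (adeleFundamentalDomain ℚ) = 1) (G : SchwartzMap ℝ ℂ)
    (h0 : G 0 = 0) (hG : ∫ t : ℝ, G t = 0) :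
    iMinus ℚ (meyerSum ℚ (ratTensor G)) ∈ Hplus ℚ μ := by
  rw [← iPlus_eq_iMinus_of_singular_zero μ hμ (ratTensor_mem_schwartzBruhatAdele G)
    (by rw [ratTensor_zero]; exact h0) (adeleFourier_ratTensor_zero μ G hG)]
  exact iPlus_mem_Hplus (ratTensor_mem_schwartzBruhatAdele G)

end Integral

end Literature.NumberTheory.Automorphic.Meyer
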